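import Summits.Ventures.PercRepro.GenQHyperplaneRowsA

/-!
# PercRepro — the trace profiles, part A: the coloop identity and the refined row (H1) (night-4, gen 11)

The hyperplane-trace block of the profile LP (`GenQHyperplaneRowsA`) counts the coloop pairs of a level in
aggregate: (H1) `Σ_m m·#Pc k m = Σ_s (n − s)·SP_{s, n−k−1}`.  The coloop count of `S = T ∪ {x}` (`T ⊆ H ∩ G`
spanning the hyperplane `H`, `x ∈ G ∖ H`) is EXACTLY one more than the coloop count of `T` inside the trace:
removing a coloop `x` from any set removes exactly `x` from its coloops (`coloopsOf_erase_of_mem_coloopsOf`, by the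
exchange property of the closure).  So the row (H1) refines class by class —

`m · #Pc k m = Σ_s (n − s) · SPm_{s, n−k−1, m−1}`   (`h1_row_refined`, `1 ≤ m`)

where `SPm_{s,j,m}` (`spSumM`) counts the rank-`(q − 1)` `j`-subsets WITH `m` COLOOPS of the `s`-point spanning
traces; `Σ_m SPm_{s,j,m} = SP_{s,j}` (`spSum_eq_sum_spSumM`).  This is the row that ties the coloop classes of `G` to the
coloop profiles of its hyperplane traces (the two-level profile LP, sheet §65 (b) (T)).  Imports
`GenQHyperplaneRowsA`.
-/
namespace PercRepro.Night4

open Finset ThmH SixFour GenQ PerFlat Star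

variable {α : Type*} [DecidableEq α] {M : Matroid α} [M.Finite]

/-! ## The coloop identity -/

/-- Removing a coloop `x` from `S` removes exactly `x` from the coloops: `coloops(S ∖ x) = coloops(S) ∖ x`.
(A coloop of `S` stays a coloop of `S ∖ x`; conversely if `y ∈ S ∖ x` is a coloop of `S ∖ x` but not of `S`, then
`y ∈ cl(S ∖ y) ∖ cl(S ∖ {x, y})`, and the exchange property puts `x ∈ cl(S ∖ x)`.) -/
theorem coloopsOf_erase_of_mem_coloopsOf {S : Finset α} {x : α} (hx : x ∈ coloopsOf M S) :
    coloopsOf M (S.erase x) = (coloopsOf M S).erase x := by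
  have hx' := mem_coloopsOf.1 hx
  ext y
  rw [Finset.mem_erase, mem_coloopsOf, mem_coloopsOf, Finset.mem_erase]
  constructor
  · rintro ⟨⟨hyx, hyS⟩, hycl⟩
    refine ⟨hyx, hyS, fun hcl => ?_⟩
    have hxSy : x ∈ S.erase y := Finset.mem_erase.2 ⟨Ne.symm hyx, hx'.1⟩
    have hySx : y ∈ S.erase x := Finset.mem_erase.2 ⟨hyx, hyS⟩
    have hA : ((S.erase y : Finset α) : Set α) = insert x (((S.erase x).erase y : Finset α) : Set α) := by
      rw [← Finset.coe_insert, Finset.erase_right_comm, Finset.insert_erase hxSy]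
    have hB : ((S.erase x : Finset α) : Set α) = insert y (((S.erase x).erase y : Finset α) : Set α) := by
      rw [← Finset.coe_insert, Finset.insert_erase hySx]
    rw [hA] at hcl
    have hex := Matroid.closure_exchange (M := M) ⟨hcl, hycl⟩
    rw [← hB] at hex
    exact hx'.2 hex.1
  · rintro ⟨hyx, hyS, hycl⟩
    refine ⟨⟨hyx, hyS⟩, fun hcl => hycl ?_⟩
    exact M.closure_subset_closure
      (Finset.coe_subset.2 (Finset.erase_subset_erase y (Finset.erase_subset x S))) hcl

/-- `m(S ∖ x) + 1 = m(S)` for a coloop `x` of `S`. -/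
theorem mTr_erase_add_one_of_mem_coloopsOf {S : Finset α} {x : α} (hx : x ∈ coloopsOf M S) :
    mTr M (S.erase x) + 1 = mTr M S := by
  unfold mTr
  rw [coloopsOf_erase_of_mem_coloopsOf hx, Finset.card_erase_add_one hx]

/-! ## The trace profiles -/

/-- The rank-`r` `j`-subsets of the trace of the flat `H` on `G` with `m` coloops:
`#{T ⊆ H ∩ G : |T| = j, rk T = r, m(T) = m}`. -/
noncomputable def spFm (M : Matroid α) [M.Finite] (G H : Finset α) (r j m : ℕ) : ℕ :=
  (((H ∩ G).powersetCard j).filter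
    (fun T : Finset α => M.eRk (T : Set α) = (r : ℕ∞) ∧ mTr M T = m)).card

/-- `SPm_{s,j,m}`: the rank-`r` `j`-subsets with `m` coloops of the `s`-point spanning traces. -/
noncomputable def spSumM (M : Matroid α) [M.Finite] (G : Finset α) (r s j m : ℕ) : ℕ :=
  ∑ H ∈ flatsTr M G r s, spFm M G H r j m

/-- `spFm ≤ spF`. -/
theorem spFm_le_spF (G H : Finset α) (r j m : ℕ) : spFm M G H r j m ≤ spF M G H r j := by
  unfold spFm spF
  refine Finset.card_le_card (fun T hT => ?_)
  rw [Finset.mem_filter] at hT ⊢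
  exact ⟨hT.1, hT.2.1⟩

/-- The coloop count of a `j`-set is at most `j`. -/
theorem mTr_le_card (T : Finset α) : mTr M T ≤ T.card := by
  unfold mTr coloopsOf
  exact Finset.card_filter_le _ _

/-- `SP` partitioned by the coloop count: `spF = Σ_{m ≤ j} spFm`. -/
theorem spF_eq_sum_spFm (G H : Finset α) (r j : ℕ) :
    spF M G H r j = ∑ m ∈ Finset.range (j + 1), spFm M G H r j m := by
  classical
  unfold spF spFm
  rw [Finset.card_eq_sum_card_fiberwise (f := fun T : Finset α => mTr M T) (t := Finset.range (j + 1))]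
  · refine Finset.sum_congr rfl (fun m _ => ?_)
    rw [Finset.filter_filter]
  · intro T hT
    rw [Finset.mem_coe, Finset.mem_filter, Finset.mem_powersetCard] at hT
    rw [Finset.mem_coe, Finset.mem_range]
    change mTr M T < j + 1
    have h1 := mTr_le_card (M := M) T
    have h2 := hT.1.2
    omega

/-- `SP_{s,j} = Σ_{m ≤ j} SPm_{s,j,m}`. -/
theorem spSum_eq_sum_spSumM (G : Finset α) (r s j : ℕ) :
    spSum M G r s j = ∑ m ∈ Finset.range (j + 1), spSumM M G r s j m := by
  unfold spSum spSumM
  rw [Finset.sum_comm]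
  refine Finset.sum_congr rfl (fun H _ => ?_)
  exact spF_eq_sum_spFm G H r j

/-- A trace of rank `< r` has no rank-`r` subset, whatever the coloop count. -/
theorem spFm_eq_zero_of_eRk_ne {G H : Finset α} {r j m : ℕ}
    (h : M.eRk ((H ∩ G : Finset α) : Set α) ≠ (r : ℕ∞)) (hle : M.eRk ((H ∩ G : Finset α) : Set α) ≤ (r : ℕ∞)) :
    spFm M G H r j m = 0 :=
  Nat.eq_zero_of_le_zero ((spFm_le_spF G H r j m).trans (spF_eq_zero_of_eRk_ne h hle).le)

/-- Regrouping a sum over the rank-`r` flats weighted by a function of the trace size, through the spanning traces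
(the `spFm` form of `sum_flatsQ_spF_eq_sum_spSum`). -/
theorem sum_flatsQ_spFm_eq_sum_spSumM (G : Finset α) (r j m : ℕ) (g : ℕ → ℕ) :
    ∑ H ∈ flatsQ M r, g (H ∩ G).card * spFm M G H r j m
      = ∑ s ∈ Finset.range (G.card + 1), g s * spSumM M G r s j m := by
  classical
  have h1 : ∑ H ∈ flatsQ M r, g (H ∩ G).card * spFm M G H r j m
      = ∑ H ∈ (flatsQ M r).filter (fun H : Finset α => M.eRk ((H ∩ G : Finset α) : Set α) = (r : ℕ∞)),
          g (H ∩ G).card * spFm M G H r j m := by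
    rw [Finset.sum_filter]
    refine Finset.sum_congr rfl (fun H hH => ?_)
    split_ifs with hsp
    · rfl
    · rw [spFm_eq_zero_of_eRk_ne hsp (eRk_inter_le_of_flatsQ hH), mul_zero]
  rw [h1, ← Finset.sum_fiberwise_of_maps_to (s := (flatsQ M r).filter
        (fun H : Finset α => M.eRk ((H ∩ G : Finset α) : Set α) = (r : ℕ∞)))
        (t := Finset.range (G.card + 1)) (g := fun H : Finset α => (H ∩ G).card)]
  · refine Finset.sum_congr rfl (fun s _ => ?_)
    unfold spSumM flatsTr
    rw [Finset.mul_sum]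
    have hfe : ((flatsQ M r).filter (fun H : Finset α => M.eRk ((H ∩ G : Finset α) : Set α) = (r : ℕ∞))).filter
        (fun H : Finset α => (H ∩ G).card = s)
        = (flatsQ M r).filter (fun H : Finset α => (H ∩ G).card = s ∧ M.eRk ((H ∩ G : Finset α) : Set α) = (r : ℕ∞)) := by
      ext H
      simp only [Finset.mem_filter]
      tauto
    rw [hfe]
    refine Finset.sum_congr rfl (fun H hH => ?_)
    have hs : (H ∩ G).card = s := ((Finset.mem_filter.1 hH).2).1
    rw [hs]
  · intro H _
    rw [Finset.mem_range]
    exact Nat.lt_succ_of_le (Finset.card_le_card (Finset.inter_subset_right))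

/-! ## The refined row (H1) -/

/-- `m · #Pc k m` as the weighted coloop pairs of level `k`: `Σ_{S ∈ levelSets k} Σ_{x ∈ coloops S} [m(S) = m]`. -/
theorem mul_card_Pc_eq_sum_coloops (G : Finset α) (q k m : ℕ) :
    m * (Pc M G q k m).card
      = ∑ S ∈ levelSets M G q k, ∑ _x ∈ coloopsOf M S, (if mTr M S = m then 1 else 0) := by
  classical
  have hfe : (levelSets M G q k).filter (fun S : Finset α => mTr M S = m) = Pc M G q k m := by
    ext S
    rw [Finset.mem_filter, mem_levelSets, mem_Pc]
    tauto
  rw [← hfe, Finset.card_eq_sum_ones, Finset.mul_sum, Finset.sum_filter]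
  refine Finset.sum_congr rfl (fun S _ => ?_)
  rw [Finset.sum_const, smul_eq_mul]
  split_ifs with hS
  · rw [mul_one, mul_one]
    exact hS.symm
  · rw [mul_zero]

/-- The coloop pairs of level `k` with `m(S) = m`, counted by the hyperplane traces: the bijection of (H1)
`(S, x) ↦ (cl(S ∖ x), x, S ∖ x)` carries `m(S) = m` to `m(S ∖ x) + 1 = m`. -/
theorem sum_coloops_class_eq_sum_hyperplanes {G : Finset α} {q k m : ℕ} (hG : G ⊆ gr M)
    (hq : 1 ≤ q) (hk : k + 1 ≤ G.card) :
    ∑ S ∈ levelSets M G q k, ∑ _x ∈ coloopsOf M S, (if mTr M S = m then 1 else 0)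
      = ∑ H ∈ flatsQ M (q - 1), ∑ _x ∈ G \ H,
          ∑ T ∈ ((H ∩ G).powersetCard (G.card - k - 1)).filter
            (fun T : Finset α => M.eRk (T : Set α) = ((q - 1 : ℕ) : ℕ∞)),
            (if mTr M T + 1 = m then 1 else 0) := by
  classical
  have hL : ∑ S ∈ levelSets M G q k, ∑ _x ∈ coloopsOf M S, (if mTr M S = m then 1 else 0)
      = ∑ p ∈ (levelSets M G q k).sigma (fun S => coloopsOf M S), (if mTr M p.1 = m then 1 else 0) := by
    rw [Finset.sum_sigma]
  have hR : ∑ H ∈ flatsQ M (q - 1), ∑ _x ∈ G \ H,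
          ∑ T ∈ ((H ∩ G).powersetCard (G.card - k - 1)).filter
            (fun T : Finset α => M.eRk (T : Set α) = ((q - 1 : ℕ) : ℕ∞)),
            (if mTr M T + 1 = m then 1 else 0)
      = ∑ p ∈ (flatsQ M (q - 1)).sigma (fun H => (G \ H) ×ˢ
          ((H ∩ G).powersetCard (G.card - k - 1)).filter
            (fun T : Finset α => M.eRk (T : Set α) = ((q - 1 : ℕ) : ℕ∞))),
          (if mTr M p.2.2 + 1 = m then 1 else 0) := by
    rw [Finset.sum_sigma]
    refine Finset.sum_congr rfl (fun H _ => ?_)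
    rw [Finset.sum_product]
  rw [hL, hR]
  refine Finset.sum_bij' (fun p _ => ⟨clF M (p.1.erase p.2), (p.2, p.1.erase p.2)⟩)
    (fun p _ => ⟨insert p.2.1 p.2.2, p.2.1⟩) ?_ ?_ ?_ ?_ ?_
  · rintro ⟨S, x⟩ hp
    rw [Finset.mem_sigma] at hp
    obtain ⟨hS, hx⟩ := hp
    have hS' := mem_levelSets.1 hS
    have hSR := mem_Rq.1 hS'.1
    have hx' := mem_coloopsOf.1 hx
    rw [Finset.mem_sigma]
    refine ⟨clF_erase_mem_flatsQ_of_mem_coloopsOf hG hS'.1 hx, ?_⟩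
    rw [Finset.mem_product]
    refine ⟨?_, ?_⟩
    · rw [Finset.mem_sdiff]
      refine ⟨hSR.1 hx'.1, ?_⟩
      rw [mem_clF]
      exact hx'.2
    · rw [Finset.mem_filter, Finset.mem_powersetCard]
      refine ⟨⟨?_, ?_⟩, eRk_erase_of_mem_coloopsOf hG hS'.1 hx⟩
      · intro y hy
        rw [Finset.mem_inter]
        refine ⟨?_, hSR.1 (Finset.erase_subset x S hy)⟩
        rw [mem_clF]
        refine M.subset_closure _ ?_ (Finset.mem_coe.2 hy)
        rw [← coe_gr M]
        exact Finset.coe_subset.2 ((Finset.erase_subset x S).trans (hSR.1.trans hG))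
      · rw [Finset.card_erase_of_mem hx'.1]
        have h1 := Finset.card_sdiff_of_subset hSR.1
        have h2 := Finset.card_le_card hSR.1
        omega
  · rintro ⟨H, x, T⟩ hp
    rw [Finset.mem_sigma, Finset.mem_product, Finset.mem_sdiff, Finset.mem_filter,
      Finset.mem_powersetCard] at hp
    obtain ⟨hH, ⟨hxG, hxH⟩, ⟨hTHG, hTcard⟩, hrT⟩ := hp
    have hTH : T ⊆ H := hTHG.trans Finset.inter_subset_left
    have hTG : T ⊆ G := hTHG.trans Finset.inter_subset_right
    have hmain := insert_mem_Rq_of_flat hG hH hTH hTG hrT hq hxG hxH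
    rw [Finset.mem_sigma]
    refine ⟨mem_levelSets.2 ⟨hmain.1, ?_⟩, hmain.2⟩
    have hxT : x ∉ T := fun h => hxH (hTH h)
    rw [Finset.card_sdiff_of_subset (Finset.insert_subset hxG hTG), Finset.card_insert_of_notMem hxT, hTcard]
    omega
  · rintro ⟨S, x⟩ hp
    rw [Finset.mem_sigma] at hp
    have hx' := mem_coloopsOf.1 hp.2
    exact Sigma.ext (Finset.insert_erase hx'.1) HEq.rfl
  · rintro ⟨H, x, T⟩ hp
    rw [Finset.mem_sigma, Finset.mem_product, Finset.mem_sdiff, Finset.mem_filter,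
      Finset.mem_powersetCard] at hp
    obtain ⟨hH, ⟨hxG, hxH⟩, ⟨hTHG, _⟩, hrT⟩ := hp
    have hH' := mem_flatsQ.1 hH
    have hTH : T ⊆ H := hTHG.trans Finset.inter_subset_left
    have hxT : x ∉ T := fun h => hxH (hTH h)
    have hcl : clF M T = H := by
      apply Finset.coe_injective
      rw [coe_clF]
      have h1 : M.closure (T : Set α) = M.closure (H : Set α) :=
        (M.isRkFinite_of_finite (Finset.finite_toSet T)).closure_eq_closure_of_subset_of_eRk_ge_eRk
          (Finset.coe_subset.2 hTH) (by rw [hrT, hH'.2.2])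
      rw [h1, hH'.2.1.closure]
    simp only [Finset.erase_insert hxT, hcl]
  · rintro ⟨S, x⟩ hp
    rw [Finset.mem_sigma] at hp
    simp only
    rw [mTr_erase_add_one_of_mem_coloopsOf hp.2]

/-- **(H1), refined by the coloop class** — the row (T5) of the two-level profile LP:
`m · #Pc k m = Σ_s (n − s) · SPm_{s, n−k−1, m−1}` for `1 ≤ m` (`n = |G|`). -/
theorem h1_row_refined {G : Finset α} {q k m : ℕ} (hG : G ⊆ gr M)
    (hq : 1 ≤ q) (hk : k + 1 ≤ G.card) (hm : 1 ≤ m) :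
    m * (Pc M G q k m).card
      = ∑ s ∈ Finset.range (G.card + 1),
          (G.card - s) * spSumM M G (q - 1) s (G.card - k - 1) (m - 1) := by
  classical
  rw [mul_card_Pc_eq_sum_coloops, sum_coloops_class_eq_sum_hyperplanes hG hq hk,
    ← sum_flatsQ_spFm_eq_sum_spSumM G (q - 1) (G.card - k - 1) (m - 1) (fun s => G.card - s)]
  refine Finset.sum_congr rfl (fun H _ => ?_)
  have hinner : ∑ T ∈ ((H ∩ G).powersetCard (G.card - k - 1)).filter
        (fun T : Finset α => M.eRk (T : Set α) = ((q - 1 : ℕ) : ℕ∞)),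
        (if mTr M T + 1 = m then 1 else 0) = spFm M G H (q - 1) (G.card - k - 1) (m - 1) := by
    unfold spFm
    rw [Finset.sum_boole, Finset.filter_filter, Nat.cast_id]
    congr 1
    refine Finset.filter_congr (fun T _ => ?_)
    constructor
    · rintro ⟨h1, h2⟩
      exact ⟨h1, by omega⟩
    · rintro ⟨h1, h2⟩
      exact ⟨h1, by omega⟩
  rw [Finset.sum_const, smul_eq_mul, hinner, card_sdiff_eq_card_sub_card_inter]

end PercRepro.Night4
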